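import Literature.Computability.QuantumComplexity.BQPSubsetPP
import Literature.Computability.Complexity.PromiseZPPProofs
import HarnessLib

/-!
# `PromiseBQP ⊆ promiseLift PP` (the promise form of Adleman–DeMarrais–Huang 1997, Thm. 6.4)

Topic `Literature/Computability/QuantumComplexity` (family `quantum-advantage`; written by the refuter seat
`refuter-cdisprove-stmt-QuantumAdvantage-13933-0`, 2026-08-16, as the promise-level separation barrier for
the route `QuantumAdvantage/CubicForrelation`). EVERYTHING here is a theorem.

The tree's discharge `BQP_subset_PP_holds` (`BQPSubsetPP.lean`) proves, for a uniform oracle-free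
Clifford+`T` family `F`, that the `P·P` presentation `x ↦ [strict majority of coin strings y have
⟨x,y⟩ ∈ adhLang F]` holds iff the count `W` of the path-pair machine is positive, and that `W > 0` when
`F` accepts `x` with probability `≥ 2/3` and `W < 0` when it accepts with probability `≤ 1/3`
(`adhW_pos`, `adhW_neg`). Nothing in this uses that the family has a gap on EVERY input, so the same
witness language separates any promise problem decided by `F`:

* `majority_mem_PP` — the `PP` language `{x | 1/2 < Pr_y[⟨x,y⟩ ∈ adhLang F]}` (coin polynomial `p`)
  lies in `PP = pMajority P`;
* `majority_iff_adhW_pos` — membership in it iff `W > 0` (for `p ≥ 2μ + 3`);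
* `PromiseBQP_subset_promiseLift_PP` — **`PromiseBQP ⊆ promiseLift PP`**: every promise problem in
  `PromiseBQP` is separated by a `PP` language (the strong, "gap everywhere is not needed because `PP` is
  syntactic" form). Consequently an explicit promise problem in `PromiseBQP ∖ PromiseBPP'` gives `P ≠ PP`
  (`P_ne_PP_of_promise_witness`, using `PromiseP_subset_PromiseBPP'`), the promise-level entry of the barrier
  `Literature.Barriers.QuantumAdvantage.SeparationPrerequisites`.

## References

* L. M. Adleman, J. DeMarrais, M.-D. A. Huang, *Quantum computability*, SIAM J. Comput. 26 (1997)
  1524–1540: Thm. 6.4 and Lemma 6.10 (pp. 1534, 1538–1539).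
* J. Watrous, *Quantum computational complexity* (2009), §III.2 (`PromiseBQP`), §IV (`BQP ⊆ PP`).
* O. Goldreich, *On promise problems* (2006), §1.1–1.2 (classes of promise problems via separating languages).
-/

noncomputable section

namespace Literature.Computability.QuantumComplexity

open _root_.Computability Polynomial Complexity Complexity.Classes Cryptography ADH

variable (F : QCircuitFamily cliffordT)

/-- The majority language `{x | 1/2 < Pr_{y ∈ {0,1}^{p |x|}}[⟨x,y⟩ ∈ adhLang F]}` of the ADH presentation
lies in `PP` for a uniform family (`adhLang F ∈ P`, Gill's `P·P`). [cite: AdlemanDeMarraisHuang1997, Thm. 6.4] -/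
theorem majority_mem_PP (hU : F.IsUniform) (p : Polynomial ℕ) :
    {x | 1 / 2 < uniformProb (p.eval x.length) {y : List Bool | boolPair x y ∈ adhLang F}} ∈ PP :=
  ⟨adhLang F, adhLang_mem_P F hU, p, fun _ => Iff.rfl⟩

/-- **Membership in the majority language is the sign of `W`** (coin polynomial `p ≥ 2μ + 3`).
[cite: AdlemanDeMarraisHuang1997, §6 Lemma 6.10 (proof, the count)] -/
theorem majority_iff_adhW_pos (hF : F.IsOracleFree) {p : Polynomial ℕ}
    (hp : ∀ n : ℕ, 2 * (F.circ n).gates.length + 3 ≤ p.eval n) (x : List Bool) :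
    1 / 2 < uniformProb (p.eval x.length) {y : List Bool | boolPair x y ∈ adhLang F} ↔
      0 < adhW (F.circ x.length).gates (w₀ F x) := by
  obtain ⟨P, hP⟩ : ∃ P, p.eval x.length =
      (F.circ x.length).gates.length + ((F.circ x.length).gates.length + (3 + P)) :=
    ⟨p.eval x.length - (2 * (F.circ x.length).gates.length + 3), by have := hp x.length; omega⟩
  have hbal := two_mul_cnt_adhLang_sub hF x P
  rw [half_lt_uniformProb_iff, hP]
  set gs := (F.circ x.length).gates with hgs
  set μ := gs.length with hμ
  have h2 : (0 : ℤ) < 2 ^ (P + 1) := by positivity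
  constructor
  · intro h
    have h' : (0 : ℤ) < 2 ^ (P + 1) * adhW gs (w₀ F x) := by rw [← hbal]; omega
    exact pos_of_mul_pos_right h' h2.le
  · intro h
    have h' : (0 : ℤ) < 2 ^ (P + 1) * adhW gs (w₀ F x) := mul_pos h2 h
    rw [← hbal] at h'
    omega

/-- **`PromiseBQP ⊆ promiseLift PP`**: a promise problem decided with error `≤ 1/3` ON ITS PROMISE by a
uniform oracle-free Clifford+`T` family is separated by the `PP` language of the ADH presentation
(`W > 0` on yes-instances by `adhW_pos`, `W < 0` on no-instances by `adhW_neg`; on the empty register the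
family accepts with probability `0`, so there are no yes-instances of length forcing `M = 0`, and
`W = -4 < 0`). [cite: AdlemanDeMarraisHuang1997, Thm. 6.4 and Lemma 6.10] -/
theorem PromiseBQP_subset_promiseLift_PP : PromiseBQP ⊆ promiseLift PP := by
  rintro Q ⟨F, hF, hU, hyes, hno⟩
  obtain ⟨p, hp⟩ := exists_coinPoly (F := F) hU
  refine ⟨{x | 1 / 2 < uniformProb (p.eval x.length) {y : List Bool | boolPair x y ∈ adhLang F}},
    majority_mem_PP F hU p, fun x hx => ?_, fun x hx => ?_⟩
  · -- yes-instances: acceptance ≥ 2/3 ⇒ W > 0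
    show 1 / 2 < uniformProb (p.eval x.length) {y : List Bool | boolPair x y ∈ adhLang F}
    rw [majority_iff_adhW_pos F hF hp x]
    by_cases hM : 0 < x.length + F.ancillas x.length
    · have h := hyes x hx
      rw [acceptProbOn_eq_probAcc hF 0 x hM] at h
      exact adhW_pos _ (hF x.length) (w₀ F x) hM h
    · exfalso
      have hM0 : x.length + F.ancillas x.length = 0 := by omega
      have h := hyes x hx
      rw [acceptProbOn_eq_zero (F := F) 0 x hM0] at h
      norm_num at h
  · -- no-instances: acceptance ≤ 1/3 ⇒ W < 0
    show ¬ 1 / 2 < uniformProb (p.eval x.length) {y : List Bool | boolPair x y ∈ adhLang F}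
    rw [majority_iff_adhW_pos F hF hp x, not_lt]
    by_cases hM : 0 < x.length + F.ancillas x.length
    · have h := hno x hx
      rw [acceptProbOn_eq_probAcc hF 0 x hM] at h
      exact (adhW_neg _ (hF x.length) (w₀ F x) hM h).le
    · have hM0 : x.length + F.ancillas x.length = 0 := by omega
      have hW4 : adhW (F.circ x.length).gates (w₀ F x) = -4 := by
        have e : ∀ (M : ℕ), M = 0 → ∀ (gs' : List (QGate cliffordT M)) (w : QReg M), adhW gs' w = -4 := by
          rintro M rfl gs' w
          rw [show gs' = [] from gates_eq_nil_of_zero ⟨gs'⟩]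
          exact adhW_nil_zero w
        exact e _ hM0 _ (w₀ F x)
      rw [hW4]; norm_num

/-- Hence an explicit promise problem in `PromiseBQP ∖ PromiseBPP'` separates `P` from `PP`
(if `P = PP` then `promiseLift PP = PromiseP ⊆ PromiseBPP'`). The promise-level form of the
Bernstein–Vazirani / ADH remark that unconditional quantum advantage needs `P ≠ PP`.
[cite: AdlemanDeMarraisHuang1997, Thm. 6.4] -/
theorem P_ne_PP_of_promise_witness {Q : PromiseProblem}
    (hQ : Q ∈ PromiseBQP) (hQ' : Q ∉ PromiseBPP') : P ≠ PP := by
  intro hP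
  have h : Q ∈ promiseLift PP := PromiseBQP_subset_promiseLift_PP hQ
  rw [← hP] at h
  exact hQ' (PromiseP_subset_PromiseBPP' h)

end Literature.Computability.QuantumComplexity

end
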